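import Summits.CriticalPhenomena.CardyFormulaZ2.Theses.CardyIKTransport
import Summits.CriticalPhenomena.CardyFormulaZ2.Theorems.CardyMagicRigidityLoopsToCrossingsStubDiscreteCrossingOfPathIn
import Summits.CriticalPhenomena.CardyFormulaZ2.Theorems.CardyMagicRigidityLoopsToCrossingsStubComparisonGeometry
import Summits.CriticalPhenomena.CardyFormulaZ2.Theorems.CardyMagicRigidityLoopsToCrossingsStubCardyContinuity
import Literature.Probability.Percolation.RSW
import Literature.Probability.Percolation.ZdNearCriticalWindow
import Literature.Probability.Percolation.SharpnessDCTProofs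
import Literature.Probability.Percolation.BoxCrossingProofs
import Literature.Probability.RandomPlanarGeometry.ConformalRectangleProofs

/-!
# `CrudeToCanonical` (item stmt-CriticalPhenomena-4968): crude Cardy on `ℤ²` implies G02 Cardy

Route `CardyIKTransport`, sub-problem `CardyFormulaZ2`, support item `CrudeToCanonical`
(global form of `DiscretisationBridge`, stmt-CriticalPhenomena-0787): if, for EVERY conformal
rectangle `R = (Ω; a, b, c, d)`, the `P_{1/2}`-probability of the crude embedded crossing event
`embDomainCrossing squareLatticeEmbedding.z Ω δ (arc 0) (arc 2)` (an open path with all vertices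
in `Ω`, endpoints within `2δ` of the two arcs; note `squareLatticeEmbedding.z = √2 · toComplex`, so
at parameter `δ / √2` this is the lattice `δℤ²` with endpoint slack `√2 δ`) tends to Cardy's value
`F(η_R)`, then so does G02's `bondDomainCrossingProb R δ` (open crossing of the largest mesh
component `Ω_δ` between the distance-comparison discrete arcs).

Proof (Bollobás–Riordan, *Percolation* (2006), Ch. 7, Lemma 14 and the remark on p. 195, in the
form already ported to bond-`ℤ²` by the line `oracle-sandwich` of the crux `LoopsToCrossings`):

* **upper half, exact inclusion** (`discreteCrossing_subset_openCrossing`): a G02 crossing of `R`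
  at mesh `δ` IS a crude crossing of `R` at parameter `δ / √2` — discrete-arc vertices lie within
  `δ ≤ √2 δ` of their arc (`infDist_le_of_mem_discreteArc`) and paths of `Ω_δ` have their vertices
  in `Ω`; hence `bond R δ ≤ crude R (δ/√2)` and `limsup ≤ F(η_R)`;
* **lower half, sandwich**: for the lower comparison quad `Q` of `R` (`exists_lowerQuad`: poking
  out of `Ω` across the arcs `0, 2`, pushed into `Ω` along the arcs `1, 3`, boundary loop and marks
  `ε₀`-close to those of `R`), every crude crossing of `Q` at parameter `δ / √2` carried by a
  lattice configuration contains a G02 crossing of `R` at mesh `δ` (`stub_discreteCrossing_of_pathIn`,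
  the deterministic bond port of Claim 19), so `crude Q (δ/√2) ≤ bond R δ` for small `δ`; by the
  hypothesis at `Q` the left side tends to `F(η_Q)`, which is within any prescribed `τ` of `F(η_R)`
  for `ε₀` small (`stub_cardyContinuity`: Radó's theorem, proved in the tree, and continuity of `F`).

## References

* B. Bollobás, O. Riordan, *Percolation*, Cambridge University Press (2006), Ch. 7, Lemma 14
  p. 184, Claim 19 p. 192, remark p. 195.
* S. Smirnov, *Critical percolation in the plane*, C. R. Acad. Sci. Paris 333 (2001), §2.
* Ch. Pommerenke, *Boundary Behaviour of Conformal Maps* (1992), Thm. 2.11 (Radó).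
-/

noncomputable section

namespace Summit.CriticalPhenomena.CardyFormulaZ2.Theorems

open Literature.Probability.RandomPlanarGeometry hiding cardyFunction
open Literature.Probability.Percolation hiding cardyFunction
open Literature.Probability.LatticeModels
open Summit.CriticalPhenomena.CardyFormulaZ2.Cruxes.LoopsToCrossings.OracleSandwich
open Filter Topology Set MeasureTheory Metric

/-! ## The crude event at parameter `δ / √2` lives on the lattice `δℤ²` -/

/-- `(δ/√2) · z(x) = δ x` for the `√2`-scaled square-lattice embedding `z = √2 · toComplex`.
[folklore] -/
theorem div_sqrt_two_mul_z (δ : ℝ) (x : Site 2) :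
    ((δ / Real.sqrt 2 : ℝ) : ℂ) * squareLatticeEmbedding.z x = meshPoint δ x := by
  show ((δ / Real.sqrt 2 : ℝ) : ℂ) * ((Real.sqrt 2 : ℂ) * Site.toComplex x) = (δ : ℂ) * Site.toComplex x
  rw [← mul_assoc, ← Complex.ofReal_mul, div_mul_cancel₀ δ (Real.sqrt_ne_zero'.2 two_pos)]

/-- `2 · (δ / √2) = √2 · δ`. [folklore] -/
theorem two_mul_div_sqrt_two (δ : ℝ) : 2 * (δ / Real.sqrt 2) = Real.sqrt 2 * δ := by
  have h2 : Real.sqrt 2 ≠ 0 := Real.sqrt_ne_zero'.2 two_pos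
  have hsq : Real.sqrt 2 * Real.sqrt 2 = 2 := Real.mul_self_sqrt zero_le_two
  calc 2 * (δ / Real.sqrt 2) = Real.sqrt 2 * Real.sqrt 2 * (δ / Real.sqrt 2) := by rw [hsq]
    _ = Real.sqrt 2 * (Real.sqrt 2 * δ / Real.sqrt 2) := by rw [mul_assoc, mul_div_assoc]
    _ = Real.sqrt 2 * δ := by rw [mul_div_cancel_left₀ δ h2]

/-- **The crude embedded crossing event of `(Ω; A, B)` for `squareLatticeEmbedding` at parameter
`δ / √2` is the open crossing, on the mesh-`δ` lattice, inside the sites with mesh point in `Ω`,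
from the sites within `√2 δ` of `A` to the sites within `√2 δ` of `B`.** [folklore] -/
theorem embDomainCrossing_div_sqrt_two (Ω A B : Set ℂ) (δ : ℝ) :
    embDomainCrossing squareLatticeEmbedding.z Ω (δ / Real.sqrt 2) A B =
      openCrossing {x : Site 2 | meshPoint δ x ∈ Ω}
        {u | infDist (meshPoint δ u) A ≤ Real.sqrt 2 * δ}
        {v | infDist (meshPoint δ v) B ≤ Real.sqrt 2 * δ} := by
  simp only [embDomainCrossing, div_sqrt_two_mul_z, two_mul_div_sqrt_two]

/-! ## Upper half: a G02 crossing is a crude crossing -/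

/-- **A G02 crossing of `Ω_δ` is a crude crossing at parameter `δ / √2`.** For `Ω` open and
`δ > 0`, Smirnov's event `discreteCrossing Ω δ A B` (an open path of the largest mesh component
`Ω_δ` between the discrete arcs of `A` and `B`) is contained in the open crossing inside the sites
of `Ω` from the sites within `√2 δ` of `A` to those within `√2 δ` of `B`: discrete-arc vertices are
within `δ` of their arc (`infDist_le_of_mem_discreteArc`, Smirnov 2001 §2) and `δ ≤ √2 δ`.
[cite: Smirnov2001, §2] -/
theorem discreteCrossing_subset_openCrossing {Ω : Set ℂ} (hΩ : IsOpen Ω) {δ : ℝ} (hδ : 0 < δ)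
    (A B : Set ℂ) :
    discreteCrossing Ω δ A B ⊆
      openCrossing {x : Site 2 | meshPoint δ x ∈ Ω}
        {u | infDist (meshPoint δ u) A ≤ Real.sqrt 2 * δ}
        {v | infDist (meshPoint δ v) B ≤ Real.sqrt 2 * δ} := by
  rintro ω ⟨x, hx, y, hy, hr⟩
  have hδ2 : |δ| ≤ Real.sqrt 2 * δ := by
    rw [abs_of_pos hδ]
    exact le_mul_of_one_le_left hδ.le Real.one_lt_sqrt_two.le
  have hxΩ : meshPoint δ x ∈ Ω := meshDomain_subset_meshVertices Ω δ hx.1.1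
  have hyΩ : meshPoint δ y ∈ Ω := meshDomain_subset_meshVertices Ω δ hy.1.1
  refine ⟨x, (infDist_le_of_mem_discreteArc hΩ hx).trans hδ2, y,
    (infDist_le_of_mem_discreteArc hΩ hy).trans hδ2, hxΩ, hyΩ, ?_⟩
  -- a path of the open domain graph is a path of the open graph induced on the sites of `Ω`
  obtain ⟨W⟩ := hr
  suffices key : ∀ (a b : Site 2) (W : (openGraph ω ⊓ discreteDomainGraph Ω δ).Walk a b)
      (ha : meshPoint δ a ∈ Ω) (hb : meshPoint δ b ∈ Ω),
      ((openGraph ω).induce {x : Site 2 | meshPoint δ x ∈ Ω}).Reachable ⟨a, ha⟩ ⟨b, hb⟩ from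
    key x y W hxΩ hyΩ
  intro a b W
  induction W with
  | nil => intro ha hb; exact SimpleGraph.Reachable.refl _
  | @cons a c b hac W ih =>
    intro ha hb
    obtain ⟨hopen, hdom⟩ := (SimpleGraph.inf_adj _ _ _ _).1 hac
    have hc : meshPoint δ c ∈ Ω :=
      meshDomain_subset_meshVertices Ω δ (discreteDomainGraph_adj_iff.1 hdom).2.2
    have hadj : ((openGraph ω).induce {x : Site 2 | meshPoint δ x ∈ Ω}).Adj ⟨a, ha⟩ ⟨c, hc⟩ := hopen
    exact hadj.reachable.trans (ih hc hb)

/-- **Upper per-mesh inequality**: `bond R δ ≤ crude R (δ / √2)` for every conformal rectangle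
and every `δ > 0`. [cite: BollobasRiordan2006, Ch. 7 remark p. 195] -/
theorem bondDomainCrossingProb_le_crude (R : ConformalRectangle) {δ : ℝ} (hδ : 0 < δ) :
    bondDomainCrossingProb R δ ≤
      (bondPercolation (zdGraph 2) half).real
        (embDomainCrossing squareLatticeEmbedding.z R.carrier (δ / Real.sqrt 2) (R.arc 0) (R.arc 2)) := by
  rw [bondDomainCrossingProb_eq_measureReal, embDomainCrossing_div_sqrt_two]
  exact measureReal_mono (discreteCrossing_subset_openCrossing R.isOpen hδ _ _)

/-! ## Lower half: a crude crossing of the lower comparison quad is a G02 crossing -/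

/-- A point at `infDist < r` from a nonempty set lies in its closed `r`-thickening. [folklore] -/
theorem mem_cthickening_of_infDist_lt {E : Set ℂ} (hE : E.Nonempty) {z : ℂ} {r s : ℝ}
    (hz : infDist z E ≤ s) (hsr : s < r) : z ∈ cthickening r E :=
  thickening_subset_cthickening r E ((mem_thickening_iff_infDist_lt hE).2 (hz.trans_lt hsr))

/-- **Lower per-mesh inequality.** Let `δ₀, t₀` be the constants of the bond port of Claim 19 for
`R` (`stub_discreteCrossing_of_pathIn`) and let `Q` be a comparison quad in lower sandwich
position with room `r`, lateral margin `m` and plate margin `t ≤ t₀` (the clauses of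
`exists_lowerQuad`). Then for `0 < δ < min δ₀ m` with `√2 δ < r`, the crude crossing probability of
`Q` at parameter `δ / √2` is at most `bond R δ`: almost every configuration is a lattice
configuration (`ae_subset_edgeSet`), its crude crossing is an open `ℤ²`-path inside the sites of
`Q` from a site `√2 δ`-close to `Q.arc 0` (hence off `Ω`, `t`-close to `R.arc 0`) to one
`√2 δ`-close to `Q.arc 2`, and the port turns it into a G02 crossing of `Ω_δ`.
[cite: BollobasRiordan2006, Ch. 7 Lemma 14 p. 184, Claim 19 p. 192] -/
theorem crude_le_bondDomainCrossingProb (R : ConformalRectangle) {δ₀ t₀ : ℝ}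
    (hAfor : ∀ δ t : ℝ, 0 < δ → δ < δ₀ → 0 ≤ t → t ≤ t₀ →
        ∀ (ω : BondConfig (Site 2)) (S : Set (Site 2)) (u v : Site 2),
          (∀ x ∈ S, meshPoint δ x ∉ R.carrier →
            infDist (meshPoint δ x) (R.arc 0) ≤ t ∨ infDist (meshPoint δ x) (R.arc 2) ≤ t) →
          (∀ x ∈ S, meshPoint δ x ∈ R.carrier →
            δ < infDist (meshPoint δ x) (R.arc 1) ∧ δ < infDist (meshPoint δ x) (R.arc 3)) →
          meshPoint δ u ∉ R.carrier → infDist (meshPoint δ u) (R.arc 0) ≤ t →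
          meshPoint δ v ∉ R.carrier → infDist (meshPoint δ v) (R.arc 2) ≤ t →
          PathIn (openGraph ω ⊓ zdGraph 2) S u v →
          ω ∈ discreteCrossing R.carrier δ (R.arc 0) (R.arc 2))
    {Q : ConformalRectangle} {r m t δ : ℝ}
    (hL1 : ∀ z ∈ cthickening r Q.carrier, z ∉ R.carrier →
      infDist z (R.arc 0) ≤ t ∨ infDist z (R.arc 2) ≤ t)
    (hL2 : ∀ z ∈ cthickening r Q.carrier, z ∈ R.carrier →
      m ≤ infDist z (R.arc 1) ∧ m ≤ infDist z (R.arc 3))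
    (hL3 : ∀ z ∈ cthickening r (Q.arc 0), z ∉ R.carrier ∧ infDist z (R.arc 0) ≤ t)
    (hL4 : ∀ z ∈ cthickening r (Q.arc 2), z ∉ R.carrier ∧ infDist z (R.arc 2) ≤ t)
    (hδ : 0 < δ) (hδ₀ : δ < δ₀) (hδm : δ < m) (hδr : Real.sqrt 2 * δ < r) (ht : 0 ≤ t)
    (htt₀ : t ≤ t₀) :
    (bondPercolation (zdGraph 2) half).real
        (embDomainCrossing squareLatticeEmbedding.z Q.carrier (δ / Real.sqrt 2) (Q.arc 0) (Q.arc 2)) ≤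
      bondDomainCrossingProb R δ := by
  rw [embDomainCrossing_div_sqrt_two, bondDomainCrossingProb_eq_measureReal]
  simp only [measureReal_def]
  refine ENNReal.toReal_mono (measure_ne_top _ _) (measure_mono_ae ?_)
  filter_upwards [ae_subset_edgeSet (zdGraph 2) half] with ω hω
  intro hoc
  obtain ⟨u, hu, v, hv, huv⟩ := mem_openCrossing_iff.1 hoc
  have hp : PathIn (openGraph ω ⊓ zdGraph 2) {x : Site 2 | meshPoint δ x ∈ Q.carrier} u v := by
    rw [openGraph_inf_eq, Set.inter_eq_left.2 hω]
    exact DCT16.pathIn_of_mem_openConnIn huv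
  have hS : ∀ x : Site 2, meshPoint δ x ∈ Q.carrier → meshPoint δ x ∈ cthickening r Q.carrier :=
    fun x hx => self_subset_cthickening _ hx
  have hu' : meshPoint δ u ∈ cthickening r (Q.arc 0) :=
    mem_cthickening_of_infDist_lt ⟨_, Q.pt_mem_arc_self 0⟩ hu hδr
  have hv' : meshPoint δ v ∈ cthickening r (Q.arc 2) :=
    mem_cthickening_of_infDist_lt ⟨_, Q.pt_mem_arc_self 2⟩ hv hδr
  exact hAfor δ t hδ hδ₀ ht htt₀ ω _ u v (fun x hx hxR => hL1 _ (hS x hx) hxR)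
    (fun x hx hxR => ⟨hδm.trans_le (hL2 _ (hS x hx) hxR).1, hδm.trans_le (hL2 _ (hS x hx) hxR).2⟩)
    (hL3 _ hu').1 (hL3 _ hu').2 (hL4 _ hv').1 (hL4 _ hv').2 hp

/-! ## The item -/

/-- `δ ↦ δ / √2` maps `δ → 0⁺` to `δ → 0⁺`. [folklore] -/
theorem tendsto_div_sqrt_two :
    Tendsto (fun δ : ℝ => δ / Real.sqrt 2) (𝓝[>] 0) (𝓝[>] 0) := by
  refine tendsto_nhdsWithin_iff.2 ⟨?_, ?_⟩
  · have h : Tendsto (fun δ : ℝ => δ / Real.sqrt 2) (𝓝 0) (𝓝 (0 / Real.sqrt 2)) :=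
      tendsto_id.div_const _
    rw [zero_div] at h
    exact h.mono_left nhdsWithin_le_nhds
  · filter_upwards [self_mem_nhdsWithin] with δ hδ
    exact div_pos hδ (Real.sqrt_pos.2 two_pos)

/-- **`CrudeToCanonical` (item stmt-CriticalPhenomena-4968).** On `ℤ²`, Cardy's formula for the
crude embedded crossing event of `squareLatticeEmbedding` in EVERY conformal rectangle implies
Cardy's formula for G02's `bondDomainCrossingProb` in every conformal rectangle. Upper half: the
exact inclusion `bond R δ ≤ crude R (δ/√2)` (`bondDomainCrossingProb_le_crude`). Lower half: for
`a < F(η_R)`, take `τ = (F(η_R) - a)/2`, the closeness budget `ε₀` of `stub_cardyContinuity`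
(Radó), the lower comparison quad `Q` of `exists_lowerQuad` at the plate margin `t₀` of the bond
port `stub_discreteCrossing_of_pathIn`, and a uniformizing datum of `Q`
(`MarkedDomain.exists_isUniformizing_holds`): then `crude Q (δ/√2) ≤ bond R δ` for small `δ`
(`crude_le_bondDomainCrossingProb`) while `crude Q (δ/√2) → F(η_Q) ≥ F(η_R) - τ > a`.
[cite: BollobasRiordan2006, Ch. 7 Lemma 14 p. 184 and remark p. 195]
[cite: Smirnov2001, §2] -/
theorem crudeToCanonical_proof :
    Summit.CriticalPhenomena.CardyFormulaZ2.Theses.CardyIKTransport.CrudeToCanonical := by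
  intro hcrude R φ x hφ
  set L := Literature.Probability.RandomPlanarGeometry.cardyFunction (crossRatio x) with hL
  have hpos : ∀ᶠ δ in 𝓝[>] (0 : ℝ), 0 < δ := self_mem_nhdsWithin
  refine tendsto_order.2 ⟨fun a ha => ?_, fun b hb => ?_⟩
  · -- lower half
    obtain ⟨ε₀, hε₀, hcont⟩ := stub_cardyContinuity R φ x hφ ((L - a) / 2) (by linarith)
    obtain ⟨m, hm, hquad⟩ := exists_lowerQuad R hε₀
    obtain ⟨δA, hδA, tA, htA, hA⟩ := stub_discreteCrossing_of_pathIn R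
    obtain ⟨Q, r, hr, hQb, hQm, c1, c2, c3, c4⟩ := hquad tA htA
    obtain ⟨ψ, y, hψ⟩ := MarkedDomain.exists_isUniformizing_holds Q
    have hclose := hcont Q hQb hQm ψ y hψ
    have hQlim := (hcrude Q ψ y hψ).comp tendsto_div_sqrt_two
    have ha' : a < Literature.Probability.RandomPlanarGeometry.cardyFunction (crossRatio y) := by
      have := (abs_le.1 hclose).1
      linarith
    have hev1 : ∀ᶠ δ in 𝓝[>] (0 : ℝ), a < (bondPercolation (zdGraph 2) half).real
        (embDomainCrossing squareLatticeEmbedding.z Q.carrier (δ / Real.sqrt 2) (Q.arc 0) (Q.arc 2)) :=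
      (tendsto_order.1 hQlim).1 a ha'
    have hev2 : ∀ᶠ δ in 𝓝[>] (0 : ℝ), δ < min (min δA m) (r / 2) :=
      mem_nhdsWithin_of_mem_nhds (Iio_mem_nhds (lt_min (lt_min hδA hm) (by linarith)))
    filter_upwards [hpos, hev1, hev2] with δ hδ h1 h2
    have hδA' : δ < δA := h2.trans_le ((min_le_left _ _).trans (min_le_left _ _))
    have hδm : δ < m := h2.trans_le ((min_le_left _ _).trans (min_le_right _ _))
    have hδr : Real.sqrt 2 * δ < r := by
      have h22 : Real.sqrt 2 < 2 := Real.sqrt_two_lt_three_halves.trans (by norm_num)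
      have : δ < r / 2 := h2.trans_le (min_le_right _ _)
      nlinarith
    exact h1.trans_le (crude_le_bondDomainCrossingProb R hA c1 c2 c3 c4 hδ hδA' hδm hδr htA.le le_rfl)
  · -- upper half
    have hRlim := (hcrude R φ x hφ).comp tendsto_div_sqrt_two
    have hev : ∀ᶠ δ in 𝓝[>] (0 : ℝ), (bondPercolation (zdGraph 2) half).real
        (embDomainCrossing squareLatticeEmbedding.z R.carrier (δ / Real.sqrt 2) (R.arc 0) (R.arc 2)) < b :=
      (tendsto_order.1 hRlim).2 b hb
    filter_upwards [hpos, hev] with δ hδ h1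
    exact (bondDomainCrossingProb_le_crude R hδ).trans_lt h1

end Summit.CriticalPhenomena.CardyFormulaZ2.Theorems
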